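import Summits.HodgeConjecture.HodgeConjecture.Theorems.Ring2AbelianAllAndreSquareDegrees
import Summits.HodgeConjecture.HodgeConjecture.Theorems.Ring2AbelianAllAndreCorrespondenceCategory
import Literature.AlgebraicGeometry.HodgeTheory.LefschetzStandardUnconditionalDegrees
import Literature.AlgebraicGeometry.HodgeTheory.CurveCorrespondencePushforward
import HarnessLib

/-!
# Ring 2 · sub-cell AbelianAll (ALL ABELIAN VARIETIES), André axis, part XXXVII-e — RELATIVE CORRESPONDENCES OF THE FIBRE SQUARE AND
# THEIR SELECTION RULES IN THE `θ_N`-WEIGHTS: `Γ_D(y) = a_*(b^* y ∪ D)` for a class `D` on `𝒳 ×_S 𝒳` is algebraic when `D` is,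
# `ν_* ∘ Γ_D = Γ_{θ_{1*} D}` exactly, `⟨Γ_D y, z⟩ = ± ⟨Γ'_D z, y⟩`; hence a class with `θ_{1*} D = Nᵉ D`, `θ_{2*} D = N^{e'} D` induces
# `Γ_D : W_{e'} → W_{2d-e}` and KILLS every other weight

HONEST FRAMING (page 1, verbatim): **research route, not a corollary; conditional on HC_CM plus one named
minimal statement.** Cell line: research route conditional on HC_CM; not a corollary; Q11.4-sentence-2
already refuted in dim ≥ 3. Nothing in this file proves a case of the Hodge conjecture for an abelian variety; `HC_CM` does not occur in
this file; item `Theses.RankFourFaces.CMToAbelian` (stmt-16267) OPEN and not closed here. Seat `pub-hodge-ring2-ab-andre-2`, gen 29;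
brief (iii). Part XXXVII derives the middle relative Lefschetz block (ρ) of ring2-b05's `B⋆(𝒳)` assembly from the fibre square by weights;
this is the selection-rule engine: THE WEIGHTS DO THE BOOKKEEPING OF THE LERAY PIECES FOR CORRESPONDENCES, which the tree cannot do
topologically (no Leray spectral sequence / fibre integration on the carriers).

## What is proved (theorems only; no definition, no named fact, no sorry; `HC_CM` absent)

Setting: `f : 𝒳 ⟶ S` a compact pencil of abelian `d`-folds, `ν ≫ f = f` charted by `N · 𝟙_A` on every fibre (`N ≥ 2`), `𝒴 = 𝒳 ×_S 𝒳` with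
projections `a, b` and partial multiplications `θ₁, θ₂` (part XXXVII-b), weights `W_j = {ν^* = Nʲ}` on `H^*(𝒳)` (parts XXV–XXXVII-a).

* §2 RELATIVE CORRESPONDENCES. For `D ∈ H^{m}(𝒴)`, `Γ_D(y) = a_*(b^* y ∪ D)` and `Γ'_D(z) = b_*(a^* z ∪ D)`:
  **`isAlgebraicCorrespondence_squareCorr`** (`D ∈ Nᵖ H^{2p}(𝒴)` ⟹ `Γ_D` algebraic: pull-back, cup with an algebraic class, push-forward);
  **`gysin_squareCorr`** (`ν_*(Γ_D y) = Γ_{θ_{1*}D}(y)`, functoriality + projection formula, EXACT); `gysin_squareCorr'` (same for `Γ'`, `θ₂`);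
  **`cupPairing_squareCorr`** (`⟨Γ_D y, z⟩ = ± ⟨Γ'_D z, y⟩`, two Gysin adjunctions).
* §3 SELECTION RULES. **`map_eq_smul_of_gysin_eq_smul`** — `ν_* u = Nᵉ u ⟹ ν^* u = N^{2d-e} u` (Gysin adjunction + weight orthogonality,
  part XXXVII-a: `u` splits into three weights and every component but the one of weight `N^{2d-e}` is orthogonal to its dual weight);
  **`squareCorr_target_weight`** — if `θ_{1*} D = Nᵉ D` then `ν^*(Γ_D y) = N^{2d-e} Γ_D y` for every `y`;
  **`squareCorr_eq_zero_of_weight_ne`** — if `θ_{2*} D = N^{e'} D` and `ν^* y = Nʲ y` with `j ≠ e'`, then `Γ_D y = 0`.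
  (Push-forward weights from pull-back weights: part XXXVII-d `gysin_eq_smul_of_map_eq_smul`.)

## Honest status

Per-pencil statements for a GIVEN fibrewise multiplication (θ∀ displayed); no node; nothing minimal; N104 untouched.

References: Kunnemann1993 (§2, Thm. 3.1); DeningerMurre1991 (Thm. 3.1); Kleiman1968AlgebraicCycles (§1.3 p. 374); Fulton1998 (Thm. 6.2 (a),
§16.1, §19.2); FultonYoungTableaux1997 (App. B §B.1 (5)–(7)); VoisinHodgeII2003 (§9.2.4 Prop. 9.20–9.21, (10.7)); HatcherAT2002 (§3.3 Prop. 3.38).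
-/

noncomputable section

set_option linter.dupNamespace false

namespace Summit.HodgeConjecture.HodgeConjecture.Ring2.AbelianAll

open CategoryTheory CategoryTheory.Limits AlgebraicGeometry MonoidalCategory CartesianMonoidalCategory
open Literature.AlgebraicGeometry Literature.AlgebraicGeometry.Motives
open Literature.AlgebraicGeometry.HodgeTheory
open Literature.AlgebraicTopology.SingularHomology (singularCohomology cupProduct cupProduct_map cupProduct_one one_cupProduct
  cupProduct_assoc cupProduct_gradedComm_holds cupPairing cupPairing_apply cupPairing_flip singularCohomologyZeroEquiv
  singularCohomologyZeroEquiv_one)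
open Summit.HodgeConjecture.HodgeConjecture.Theorems (deg_fiberGysin_aux cupPairing_complexGysin_complexOrientationFamily)

/-! ## §2 Relative correspondences `Γ_D(y) = a_*(b^* y ∪ D)` of the square -/

section Correspondences

variable {𝒳 S : SchemeOver ℂ} {d : ℕ} {f : 𝒳 ⟶ S}

local notation3 (prettyPrint := false) "𝒴[" f "]" => familyPullback f f
local notation3 (prettyPrint := false) "𝐚[" f "]" => familyPullback.fst f f
local notation3 (prettyPrint := false) "𝐛[" f "]" => familyPullback.snd f f
/-- `hY⟦hf⟧` — the square is a smooth projective `(2d+1)`-fold (part XXXIII-b). -/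
local notation3 (prettyPrint := false) "hY⟦" hf "⟧" =>
  IsCompactAbelianPencil.isSmoothProjective_total (isCompactAbelianPencil_square hf rfl)

/-- **`Γ_D = a_* ∘ (· ∪ D) ∘ b^*` IS AN ALGEBRAIC CORRESPONDENCE when `D ∈ Nᵖ H^{2p}(𝒴)`** (pull-back along `b`, cup product with an
algebraic class, Gysin push-forward along `a` — each an algebraic correspondence on the carriers, and composites are).
[cite: Fulton1998, §16.1 Def. 16.1.1 and Prop. 16.1.1] [cite: VoisinHodgeII2003, §9.2.4 Prop. 9.21 and (10.7)] -/
theorem isAlgebraicCorrespondence_squareCorr (hf : IsCompactAbelianPencil f d) {p k kp c : ℕ} (hkp : k + 2 * p = kp)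
    (hc : kp + 2 * (d + 1) = c + 2 * (d + d + 1)) (hcle : c ≤ 2 * (d + 1)) {D : complexBetti 𝒴[f] (2 * p)}
    (hD : D ∈ algebraicClasses 𝒴[f] p) :
    IsAlgebraicCorrespondence (d + 1) (d + 1) 𝒳 𝒳
      (complexGysin complexOrientationFamily hY⟦hf⟧ hf.isSmoothProjective_total 𝐚[f] hc ∘ₗ
        ((cupProduct hkp).flip D ∘ₗ (complexBetti.map 𝐛[f] k).hom)) := by
  have h𝒳 := hf.isSmoothProjective_total
  have hY := hY⟦hf⟧
  refine IsAlgebraicCorrespondence.comp h𝒳 hY h𝒳 ?_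
    (isAlgebraicCorrespondence_complexGysin complexOrientationFamily hasPoincareDuality_complexOrientationFamily hY h𝒳 𝐚[f] hc
      (q := 2 * (d + 1) - c) (by omega)) (by omega)
  exact IsAlgebraicCorrespondence.comp hY hY h𝒳 (isAlgebraicCorrespondence_map hY h𝒳 𝐛[f] (by omega))
    (isAlgebraicCorrespondence_flip_cupProduct_of_mem_algebraicClasses hY hkp (by omega) hD) (by omega)

/-- **`ν_* ∘ Γ_D = Γ_{θ_{1*} D}` EXACTLY**: `ν_*(a_*(b^* y ∪ D)) = a_*(θ_{1*}(θ₁^* b^* y ∪ D)) = a_*(b^* y ∪ θ_{1*} D)` (`a θ₁ = ν a`,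
`b θ₁ = b`, functoriality of Gysin maps and the projection formula). [cite: FultonYoungTableaux1997, Appendix B §B.1 (5)–(6)] -/
theorem gysin_squareCorr (hf : IsCompactAbelianPencil f d) (ν : 𝒳 ⟶ 𝒳) {θ₁ : 𝒴[f] ⟶ 𝒴[f]} (h1a : θ₁ ≫ 𝐚[f] = 𝐚[f] ≫ ν)
    (h1b : θ₁ ≫ 𝐛[f] = 𝐛[f]) {k m km c : ℕ} (hkm : k + m = km) (hc : km + 2 * (d + 1) = c + 2 * (d + d + 1))
    (D : complexBetti 𝒴[f] m) (y : complexBetti 𝒳 k) :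
    complexGysin complexOrientationFamily hf.isSmoothProjective_total hf.isSmoothProjective_total ν (rfl : c + 2 * (d + 1) = c + 2 * (d + 1))
      (complexGysin complexOrientationFamily hY⟦hf⟧ hf.isSmoothProjective_total 𝐚[f] hc
        (cupProduct hkm (complexBetti.map 𝐛[f] k y) D)) =
      complexGysin complexOrientationFamily hY⟦hf⟧ hf.isSmoothProjective_total 𝐚[f] hc
        (cupProduct hkm (complexBetti.map 𝐛[f] k y)
          (complexGysin complexOrientationFamily hY⟦hf⟧ hY⟦hf⟧ θ₁ (rfl : m + 2 * (d + d + 1) = m + 2 * (d + d + 1)) D)) := by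
  have h𝒳 := hf.isSmoothProjective_total
  have hY := hY⟦hf⟧
  have hμ := hasPoincareDuality_complexOrientationFamily
  -- `ν_* a_* = (a ≫ ν)_* = (θ₁ ≫ a)_* = a_* θ_{1*}`
  rw [← LinearMap.comp_apply, ← complexGysin_comp hμ hY h𝒳 h𝒳 𝐚[f] ν hc rfl,
    show 𝐚[f] ≫ ν = θ₁ ≫ 𝐚[f] from h1a.symm,
    complexGysin_comp hμ hY hY h𝒳 θ₁ 𝐚[f] (rfl : km + 2 * (d + d + 1) = km + 2 * (d + d + 1)) hc, LinearMap.comp_apply]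
  congr 1
  -- `θ_{1*}(b^* y ∪ D) = θ_{1*}(θ₁^* b^* y ∪ D) = b^* y ∪ θ_{1*} D`
  have hby : complexBetti.map 𝐛[f] k y = complexBetti.map θ₁ k (complexBetti.map 𝐛[f] k y) := by
    rw [← complexBetti.map_comp_apply', h1b]
  conv_lhs => rw [hby]
  exact complexGysin_cup hμ hY hY θ₁ hkm rfl rfl hkm (complexBetti.map 𝐛[f] k y) D

/-- **`ν_* ∘ Γ'_D = Γ'_{θ_{2*} D}`** (the transposed correspondence `Γ'_D(z) = b_*(a^* z ∪ D)`, with `θ₂ = 1 ×_S ν`).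
[cite: FultonYoungTableaux1997, Appendix B §B.1 (5)–(6)] -/
theorem gysin_squareCorr' (hf : IsCompactAbelianPencil f d) (ν : 𝒳 ⟶ 𝒳) {θ₂ : 𝒴[f] ⟶ 𝒴[f]} (h2a : θ₂ ≫ 𝐚[f] = 𝐚[f])
    (h2b : θ₂ ≫ 𝐛[f] = 𝐛[f] ≫ ν) {k m km c : ℕ} (hkm : k + m = km) (hc : km + 2 * (d + 1) = c + 2 * (d + d + 1))
    (D : complexBetti 𝒴[f] m) (z : complexBetti 𝒳 k) :
    complexGysin complexOrientationFamily hf.isSmoothProjective_total hf.isSmoothProjective_total ν (rfl : c + 2 * (d + 1) = c + 2 * (d + 1))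
      (complexGysin complexOrientationFamily hY⟦hf⟧ hf.isSmoothProjective_total 𝐛[f] hc
        (cupProduct hkm (complexBetti.map 𝐚[f] k z) D)) =
      complexGysin complexOrientationFamily hY⟦hf⟧ hf.isSmoothProjective_total 𝐛[f] hc
        (cupProduct hkm (complexBetti.map 𝐚[f] k z)
          (complexGysin complexOrientationFamily hY⟦hf⟧ hY⟦hf⟧ θ₂ (rfl : m + 2 * (d + d + 1) = m + 2 * (d + d + 1)) D)) := by
  have h𝒳 := hf.isSmoothProjective_total
  have hY := hY⟦hf⟧
  have hμ := hasPoincareDuality_complexOrientationFamily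
  rw [← LinearMap.comp_apply, ← complexGysin_comp hμ hY h𝒳 h𝒳 𝐛[f] ν hc rfl,
    show 𝐛[f] ≫ ν = θ₂ ≫ 𝐛[f] from h2b.symm,
    complexGysin_comp hμ hY hY h𝒳 θ₂ 𝐛[f] (rfl : km + 2 * (d + d + 1) = km + 2 * (d + d + 1)) hc, LinearMap.comp_apply]
  congr 1
  have haz : complexBetti.map 𝐚[f] k z = complexBetti.map θ₂ k (complexBetti.map 𝐚[f] k z) := by
    rw [← complexBetti.map_comp_apply', h2a]
  conv_lhs => rw [haz]
  exact complexGysin_cup hμ hY hY θ₂ hkm rfl rfl hkm (complexBetti.map 𝐚[f] k z) D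

/-- **TRANSPOSITION: `⟨Γ_D y, z⟩_𝒳 = ± ⟨Γ'_D z, y⟩_𝒳`** — both equal `± ⟨b^* y ∪ D ∪ a^* z, [𝒴]⟩` (Gysin adjunction for `a` and for `b`,
associativity and graded commutativity of `∪`). [cite: FultonYoungTableaux1997, Appendix B §B.1 (5)–(6)] [cite: HatcherAT2002, §3.2 Thm. 3.11] -/
theorem cupPairing_squareCorr (hf : IsCompactAbelianPencil f d) {k m l km lm c c' : ℕ} (hkm : k + m = km) (hlm : l + m = lm)
    (hc : km + 2 * (d + 1) = c + 2 * (d + d + 1)) (hc' : lm + 2 * (d + 1) = c' + 2 * (d + d + 1))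
    (hcl : c + l = 2 * (d + 1)) (hck : c' + k = 2 * (d + 1))
    (D : complexBetti 𝒴[f] m) (y : complexBetti 𝒳 k) (z : complexBetti 𝒳 l) :
    cupPairing (complexOrientationFamily hf.isSmoothProjective_total) hcl
      (complexGysin complexOrientationFamily hY⟦hf⟧ hf.isSmoothProjective_total 𝐚[f] hc (cupProduct hkm (complexBetti.map 𝐛[f] k y) D)) z =
      ((-1 : ℂ) ^ (km * l) * (-1 : ℂ) ^ (k * m)) •
      cupPairing (complexOrientationFamily hf.isSmoothProjective_total) hck
        (complexGysin complexOrientationFamily hY⟦hf⟧ hf.isSmoothProjective_total 𝐛[f] hc' (cupProduct hlm (complexBetti.map 𝐚[f] l z) D))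
        y := by
  have h𝒳 := hf.isSmoothProjective_total
  have hY := hY⟦hf⟧
  have htop : km + l = 2 * (d + d + 1) := by omega
  have htop' : lm + k = 2 * (d + d + 1) := by omega
  have hmk : m + k = km := by omega
  have h'' : l + km = 2 * (d + d + 1) := by omega
  rw [cupPairing_complexGysin_complexOrientationFamily 𝐚[f] h𝒳 hY hc htop hcl,
    cupPairing_complexGysin_complexOrientationFamily 𝐛[f] h𝒳 hY hc' htop' hck, cupPairing_apply, cupPairing_apply]
  -- `(b^*y ∪ D) ∪ a^*z = ± a^*z ∪ (b^*y ∪ D) = ± a^*z ∪ (D ∪ b^*y) = ± (a^*z ∪ D) ∪ b^*y`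
  have e1 : cupProduct htop (cupProduct hkm (complexBetti.map 𝐛[f] k y) D) (complexBetti.map 𝐚[f] l z) =
      ((-1 : ℂ) ^ (km * l)) • cupProduct h'' (complexBetti.map 𝐚[f] l z) (cupProduct hkm (complexBetti.map 𝐛[f] k y) D) :=
    cupProduct_gradedComm_holds ℂ (ComplexPoints 𝒴[f]) htop h'' _ _
  have e2 : cupProduct hkm (complexBetti.map 𝐛[f] k y) D = ((-1 : ℂ) ^ (k * m)) • cupProduct hmk D (complexBetti.map 𝐛[f] k y) :=
    cupProduct_gradedComm_holds ℂ (ComplexPoints 𝒴[f]) hkm hmk _ _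
  have e3 : cupProduct h'' (complexBetti.map 𝐚[f] l z) (cupProduct hmk D (complexBetti.map 𝐛[f] k y)) =
      cupProduct htop' (cupProduct hlm (complexBetti.map 𝐚[f] l z) D) (complexBetti.map 𝐛[f] k y) :=
    (cupProduct_assoc hlm hmk htop' h'' _ _ _).symm
  rw [e1, e2, map_smul, map_smul, e3, map_smul, LinearMap.smul_apply, LinearMap.smul_apply, smul_smul]

end Correspondences

/-! ## §3 Selection rules -/

section Selection

variable {𝒳 S : SchemeOver ℂ} {d : ℕ} {f : 𝒳 ⟶ S}

local notation3 (prettyPrint := false) "𝒴[" f "]" => familyPullback f f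
local notation3 (prettyPrint := false) "𝐚[" f "]" => familyPullback.fst f f
local notation3 (prettyPrint := false) "𝐛[" f "]" => familyPullback.snd f f
local notation3 (prettyPrint := false) "hY⟦" hf "⟧" =>
  IsCompactAbelianPencil.isSmoothProjective_total (isCompactAbelianPencil_square hf rfl)

/-- **`ν_* u = Nᵉ u ⟹ ν^* u = N^{2d-e} u`** (`u ∈ H^{k+2}(𝒳)`, `k, e ≤ 2d`). By the Gysin adjunction `⟨ν_* u, w⟩ = ⟨u, ν^* w⟩`, `u` is
orthogonal to every weight `N^{j'}` with `j' ≠ e`; splitting `u` into its three weights (part XXXVI-b), each component of weight `j` with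
`2d - j ≠ e` is orthogonal to its dual weight and vanishes (part XXXVII-a); so `u` is its component of weight `N^{2d-e}`.
[cite: DeningerMurre1991, Thm. 3.1] [cite: HatcherAT2002, §3.3 Prop. 3.38] -/
theorem map_eq_smul_of_gysin_eq_smul (hf : IsCompactAbelianPencil f d) (t : ComplexPoints S) (ν : 𝒳 ⟶ 𝒳) (hν : ν ≫ f = f)
    {N : ℕ} (hN : 2 ≤ N)
    (hθ : ∀ s : ComplexPoints S, ∃ (νs : fiberOver f s ⟶ fiberOver f s) (A : AbelianVariety ℂ) (e : A.X ≅ fiberOver f s),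
      νs ≫ fiberι f s = fiberι f s ≫ ν ∧ e.hom ≫ νs = (N • 𝟙 A).hom.hom.hom ≫ e.hom)
    {k : ℕ} (hk2 : k + 2 ≤ 2 * d) {e : ℕ} (u : complexBetti 𝒳 (k + 2))
    (hu : complexGysin complexOrientationFamily hf.isSmoothProjective_total hf.isSmoothProjective_total ν
      (rfl : k + 2 + 2 * (d + 1) = k + 2 + 2 * (d + 1)) u = ((N : ℂ) ^ e) • u) :
    complexBetti.map ν (k + 2) u = ((N : ℂ) ^ (2 * d - e)) • u := by
  have h𝒳 := hf.isSmoothProjective_total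
  have hk : k ≤ 2 * d := by omega
  -- the complementary degree `k' + 2` with `k + 2 + (k' + 2) = 2d + 2`
  obtain ⟨k', hk'⟩ : ∃ k', k + 2 + (k' + 2) = 2 * (d + 1) := ⟨2 * d - k - 2, by omega⟩
  have hk'le : k' ≤ 2 * d := by omega
  -- `u ⊥ W_{j'}` for `j' ≠ e`
  have horth : ∀ {j' : ℕ} (w : complexBetti 𝒳 (k' + 2)), j' ≠ e → complexBetti.map ν (k' + 2) w = ((N : ℂ) ^ j') • w →
      cupPairing (complexOrientationFamily h𝒳) hk' u w = 0 := by
    intro j' w hj' hw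
    have h1 : cupPairing (complexOrientationFamily h𝒳) hk'
        (complexGysin complexOrientationFamily h𝒳 h𝒳 ν (rfl : k + 2 + 2 * (d + 1) = k + 2 + 2 * (d + 1)) u) w =
        cupPairing (complexOrientationFamily h𝒳) hk' u (complexBetti.map ν (k' + 2) w) :=
      cupPairing_complexGysin_complexOrientationFamily ν h𝒳 h𝒳 rfl hk' hk' u w
    rw [hu, hw, map_smul, map_smul, LinearMap.smul_apply] at h1
    have h2 : ((N : ℂ) ^ e - (N : ℂ) ^ j') • cupPairing (complexOrientationFamily h𝒳) hk' u w = 0 := by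
      rw [sub_smul, h1, sub_self]
    exact (smul_eq_zero.1 h2).resolve_left (sub_ne_zero.2 (natCast_pow_ne_pow hN (Ne.symm hj')))
  -- a component of weight `j` whose pairing with the dual weight `2d - j` is that of `u` vanishes unless `j + e = 2d`
  have hkill : ∀ {j : ℕ} (uj : complexBetti 𝒳 (k + 2)), complexBetti.map ν (k + 2) uj = ((N : ℂ) ^ j) • uj →
      (∀ (j' : ℕ) (w : complexBetti 𝒳 (k' + 2)), j + j' = 2 * d → complexBetti.map ν (k' + 2) w = ((N : ℂ) ^ j') • w →
        cupPairing (complexOrientationFamily h𝒳) hk' uj w = cupPairing (complexOrientationFamily h𝒳) hk' u w) →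
      j + e ≠ 2 * d → uj = 0 := by
    intro j uj huj hrest hje
    refine eq_zero_of_forall_cupPairing_eq_zero complexOrientationFamily h𝒳 hk' fun z ↦ ?_
    obtain ⟨f₀, f₁, f₂, -, -, hsum', hwt', -⟩ := exists_leraySplitting hf t ν hν hN hθ hk'le
    obtain ⟨g₀, g₁, g₂⟩ := hwt' z
    have hcomp : ∀ (j' : ℕ) (w : complexBetti 𝒳 (k' + 2)), complexBetti.map ν (k' + 2) w = ((N : ℂ) ^ j') • w →
        cupPairing (complexOrientationFamily h𝒳) hk' uj w = 0 := by
      intro j' w hw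
      by_cases hjj : j + j' = 2 * d
      · rw [hrest j' w hjj hw]
        exact horth w (by omega) hw
      · exact cupPairing_eq_zero_of_weights hf t ν hν hN (hθ t) hk' hjj huj hw
    rw [← hsum' z, map_add, map_add, hcomp _ _ g₀, hcomp _ _ g₁, hcomp _ _ g₂, add_zero, add_zero]
  -- split `u` into its three weights; the pairing of a component with its dual weight is that of `u`
  obtain ⟨e₀, e₁, e₂, -, -, hsum, hwt, -⟩ := exists_leraySplitting hf t ν hν hN hθ hk
  obtain ⟨h₀, h₁, h₂⟩ := hwt u
  have hrest₀ : ∀ (j' : ℕ) (w : complexBetti 𝒳 (k' + 2)), k + 2 + j' = 2 * d → complexBetti.map ν (k' + 2) w = ((N : ℂ) ^ j') • w →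
      cupPairing (complexOrientationFamily h𝒳) hk' (e₀ u) w = cupPairing (complexOrientationFamily h𝒳) hk' u w := by
    intro j' w hj' hw
    conv_rhs => rw [← hsum u]
    rw [map_add, map_add, LinearMap.add_apply, LinearMap.add_apply,
      cupPairing_eq_zero_of_weights hf t ν hν hN (hθ t) hk' (show k + 1 + j' ≠ 2 * d by omega) h₁ hw,
      cupPairing_eq_zero_of_weights hf t ν hν hN (hθ t) hk' (show k + j' ≠ 2 * d by omega) h₂ hw, add_zero, add_zero]
  have hrest₁ : ∀ (j' : ℕ) (w : complexBetti 𝒳 (k' + 2)), k + 1 + j' = 2 * d → complexBetti.map ν (k' + 2) w = ((N : ℂ) ^ j') • w →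
      cupPairing (complexOrientationFamily h𝒳) hk' (e₁ u) w = cupPairing (complexOrientationFamily h𝒳) hk' u w := by
    intro j' w hj' hw
    conv_rhs => rw [← hsum u]
    rw [map_add, map_add, LinearMap.add_apply, LinearMap.add_apply,
      cupPairing_eq_zero_of_weights hf t ν hν hN (hθ t) hk' (show k + 2 + j' ≠ 2 * d by omega) h₀ hw,
      cupPairing_eq_zero_of_weights hf t ν hν hN (hθ t) hk' (show k + j' ≠ 2 * d by omega) h₂ hw, zero_add, add_zero]
  have hrest₂ : ∀ (j' : ℕ) (w : complexBetti 𝒳 (k' + 2)), k + j' = 2 * d → complexBetti.map ν (k' + 2) w = ((N : ℂ) ^ j') • w →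
      cupPairing (complexOrientationFamily h𝒳) hk' (e₂ u) w = cupPairing (complexOrientationFamily h𝒳) hk' u w := by
    intro j' w hj' hw
    conv_rhs => rw [← hsum u]
    rw [map_add, map_add, LinearMap.add_apply, LinearMap.add_apply,
      cupPairing_eq_zero_of_weights hf t ν hν hN (hθ t) hk' (show k + 2 + j' ≠ 2 * d by omega) h₀ hw,
      cupPairing_eq_zero_of_weights hf t ν hν hN (hθ t) hk' (show k + 1 + j' ≠ 2 * d by omega) h₁ hw, zero_add, zero_add]
  -- conclude by cases on which of the three weights is `2d - e`
  by_cases hc₀ : k + 2 + e = 2 * d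
  · have hz₁ : e₁ u = 0 := hkill (e₁ u) h₁ hrest₁ (by omega)
    have hz₂ : e₂ u = 0 := hkill (e₂ u) h₂ hrest₂ (by omega)
    have hu' : u = e₀ u := by conv_lhs => rw [← hsum u, hz₁, hz₂, add_zero, add_zero]
    rw [hu', h₀, show 2 * d - e = k + 2 by omega]
  by_cases hc₁ : k + 1 + e = 2 * d
  · have hz₀ : e₀ u = 0 := hkill (e₀ u) h₀ hrest₀ (by omega)
    have hz₂ : e₂ u = 0 := hkill (e₂ u) h₂ hrest₂ (by omega)
    have hu' : u = e₁ u := by conv_lhs => rw [← hsum u, hz₀, hz₂, zero_add, add_zero]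
    rw [hu', h₁, show 2 * d - e = k + 1 by omega]
  by_cases hc₂ : k + e = 2 * d
  · have hz₀ : e₀ u = 0 := hkill (e₀ u) h₀ hrest₀ (by omega)
    have hz₁ : e₁ u = 0 := hkill (e₁ u) h₁ hrest₁ (by omega)
    have hu' : u = e₂ u := by conv_lhs => rw [← hsum u, hz₀, hz₁, zero_add, zero_add]
    rw [hu', h₂, show 2 * d - e = k by omega]
  · have hz₀ : e₀ u = 0 := hkill (e₀ u) h₀ hrest₀ (by omega)
    have hz₁ : e₁ u = 0 := hkill (e₁ u) h₁ hrest₁ (by omega)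
    have hz₂ : e₂ u = 0 := hkill (e₂ u) h₂ hrest₂ (by omega)
    have hu' : u = 0 := by rw [← hsum u, hz₀, hz₁, hz₂, add_zero, add_zero]
    rw [hu', map_zero, smul_zero]

/-- **TARGET RULE: if `θ_{1*} D = Nᵉ D` then every `Γ_D y` has weight `N^{2d-e}`** (`ν_* Γ_D y = Γ_{θ_{1*}D} y = Nᵉ Γ_D y`, §2, then
`map_eq_smul_of_gysin_eq_smul`). [cite: Kunnemann1993, §2] [cite: DeningerMurre1991, Thm. 3.1] -/
theorem squareCorr_target_weight (hf : IsCompactAbelianPencil f d) (t : ComplexPoints S) (ν : 𝒳 ⟶ 𝒳) (hν : ν ≫ f = f)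
    {N : ℕ} (hN : 2 ≤ N)
    (hθ : ∀ s : ComplexPoints S, ∃ (νs : fiberOver f s ⟶ fiberOver f s) (A : AbelianVariety ℂ) (e : A.X ≅ fiberOver f s),
      νs ≫ fiberι f s = fiberι f s ≫ ν ∧ e.hom ≫ νs = (N • 𝟙 A).hom.hom.hom ≫ e.hom)
    {θ₁ : 𝒴[f] ⟶ 𝒴[f]} (h1a : θ₁ ≫ 𝐚[f] = 𝐚[f] ≫ ν) (h1b : θ₁ ≫ 𝐛[f] = 𝐛[f])
    {k m km c : ℕ} (hkm : k + m = km) (hc : km + 2 * (d + 1) = c + 2 + 2 * (d + d + 1)) (hcd : c + 2 ≤ 2 * d)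
    {e : ℕ} {D : complexBetti 𝒴[f] m}
    (hD : complexGysin complexOrientationFamily hY⟦hf⟧ hY⟦hf⟧ θ₁ (rfl : m + 2 * (d + d + 1) = m + 2 * (d + d + 1)) D = ((N : ℂ) ^ e) • D)
    (y : complexBetti 𝒳 k) :
    complexBetti.map ν (c + 2)
      (complexGysin complexOrientationFamily hY⟦hf⟧ hf.isSmoothProjective_total 𝐚[f] hc (cupProduct hkm (complexBetti.map 𝐛[f] k y) D)) =
      ((N : ℂ) ^ (2 * d - e)) •
        complexGysin complexOrientationFamily hY⟦hf⟧ hf.isSmoothProjective_total 𝐚[f] hc (cupProduct hkm (complexBetti.map 𝐛[f] k y) D) := by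
  refine map_eq_smul_of_gysin_eq_smul hf t ν hν hN hθ hcd _ ?_
  rw [gysin_squareCorr hf ν h1a h1b hkm hc D y, hD, map_smul, map_smul]

/-- **SOURCE RULE: if `θ_{2*} D = N^{e'} D` then `Γ_D` KILLS every class of weight `Nʲ`, `j ≠ e'`.** By transposition (§2) `⟨Γ_D y, z⟩ =
± ⟨Γ'_D z, y⟩`, where `Γ'_D z` has weight `N^{2d-e'}` (target rule for `Γ'`); weights `j` and `2d - e'` pair to zero unless `j = e'`
(part XXXVII-a); Poincaré duality. [cite: Kunnemann1993, §2] [cite: DeningerMurre1991, Thm. 3.1] [cite: HatcherAT2002, §3.3 Prop. 3.38] -/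
theorem squareCorr_eq_zero_of_weight_ne (hf : IsCompactAbelianPencil f d) (t : ComplexPoints S) (ν : 𝒳 ⟶ 𝒳) (hν : ν ≫ f = f)
    {N : ℕ} (hN : 2 ≤ N)
    (hθ : ∀ s : ComplexPoints S, ∃ (νs : fiberOver f s ⟶ fiberOver f s) (A : AbelianVariety ℂ) (e : A.X ≅ fiberOver f s),
      νs ≫ fiberι f s = fiberι f s ≫ ν ∧ e.hom ≫ νs = (N • 𝟙 A).hom.hom.hom ≫ e.hom)
    {θ₂ : 𝒴[f] ⟶ 𝒴[f]} (h2a : θ₂ ≫ 𝐚[f] = 𝐚[f]) (h2b : θ₂ ≫ 𝐛[f] = 𝐛[f] ≫ ν)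
    {k m l km lm c c' : ℕ} (hkm : k + m = km) (hlm : l + 2 + m = lm)
    (hc : km + 2 * (d + 1) = c + 2 * (d + d + 1)) (hc' : lm + 2 * (d + 1) = c' + 2 + 2 * (d + d + 1))
    (hcl : c + (l + 2) = 2 * (d + 1)) (hck : c' + 2 + k = 2 * (d + 1)) (hc'd : c' + 2 ≤ 2 * d)
    {e' : ℕ} (he' : e' ≤ 2 * d) {D : complexBetti 𝒴[f] m}
    (hD : complexGysin complexOrientationFamily hY⟦hf⟧ hY⟦hf⟧ θ₂ (rfl : m + 2 * (d + d + 1) = m + 2 * (d + d + 1)) D = ((N : ℂ) ^ e') • D)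
    {j : ℕ} (hj : j ≠ e') {y : complexBetti 𝒳 k} (hy : complexBetti.map ν k y = ((N : ℂ) ^ j) • y) :
    complexGysin complexOrientationFamily hY⟦hf⟧ hf.isSmoothProjective_total 𝐚[f] hc (cupProduct hkm (complexBetti.map 𝐛[f] k y) D) = 0 := by
  have h𝒳 := hf.isSmoothProjective_total
  refine eq_zero_of_forall_cupPairing_eq_zero complexOrientationFamily h𝒳 hcl fun z ↦ ?_
  rw [cupPairing_squareCorr hf hkm hlm hc hc' hcl hck D y z]
  -- `Γ'_D z` has weight `2d - e'`, `y` has weight `j`, and `j + (2d - e') ≠ 2d`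
  have hw := map_eq_smul_of_gysin_eq_smul hf t ν hν hN hθ hc'd _
    (by rw [gysin_squareCorr' hf ν h2a h2b hlm hc' D z, hD, map_smul, map_smul])
  rw [cupPairing_eq_zero_of_weights hf t ν hν hN (hθ t) hck (show 2 * d - e' + j ≠ 2 * d by omega) hw hy, smul_zero]

end Selection

end Summit.HodgeConjecture.HodgeConjecture.Ring2.AbelianAll

end
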